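import Literature.Combinatorics.Designs.DifferenceSetMultiplier
import Literature.Combinatorics.Designs.GoethalsSeidelArray
import Mathlib.Data.ZMod.Basic
import Mathlib.Tactic.NormNum.Prime

/-!
# H(668), family F10 (one circulant core): no cyclic `(667, 333, 166)` difference set — kernel theorem
Framing: lottery ticket; floor = certified bounds/negative ranges.

Cell `pub-namedobj`, target H. An `H(668)` with a CIRCULANT CORE (border normalised, core circulant of order `667`,
`C Cᵀ = 668·I - J`) is the same as a `±1` sequence of length `667` with periodic autocorrelation `-1` off-peak, i.e. a
cyclic Paley–Hadamard `(667, 333, 166)` difference set. In print it is excluded (Song–Golomb 1994: all `v < 10⁴` outside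
the classical families `v` prime / twin-prime product / `2^m - 1` bar 17 cases; `667 = 23·29` is in none; Baumert–Gordon
2004 = arXiv:math/0304502 §4); the census row F10 (hadamard g4) re-derived it twice by computation. Here, with no search:
* `no_cyclic_hadamard_differenceSet_667` — no `D ⊆ ℤ/667`, `|D| = 333`, `IsDifferenceSet D 166`. Proof: a translate
  with element-sum `0` exists (`gcd(333,667) = 1`, Lander Thm 5.10, Literature `DifferenceSetMultiplier`); by **Hall's
  multiplier theorem** (Lander Thm 5.3, ibid.) `167 = n > λ = 166`, `167 ∤ 667` is a multiplier fixing it; modulo `29`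
  (`167 ≡ 22`, inverse `4`) the fibre counts are constant on the two orbits of `22` (squares / non-squares), so
  `c₀ + 14b + 14b' = 333` and — counting ordered pairs with equal residue through the kernel of order `23`
  (`sum_sq_fiberCard`) — `c₀² + 14b² + 14b'² = k + 22λ = 3985`, which has no solution in ℕ (`no_nat_solution`, `decide`).
* `no_twoLevel_autocorrelation_667` — no `±1` sequence `c : ℤ/667 → ℤ` (Literature `LegendrePairs`: `IsPM`, `PAF`) has
  `PAF_c(s) = -1` for all `s ≠ 0` (`differenceSet_of_paf`: `PAF ≡ -1 ⇒ (v, (v-1)/2, (v-3)/4)` difference set).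
* `no_hadamard668_circulant_core` — no matrix on `Option (ℤ/667)` with border column `+1` and circulant core `c (j - i)`
  is an `IsHadamardMatrix` (Literature `GoethalsSeidelArray`): NO H(668) WITH A CIRCULANT CORE.
Evidence class: KERNEL replication of a printed exclusion (no novelty claim). No `sorry`, no new axioms; zero compute.
-/
namespace Summit.Ventures.DiscreteObjects.Hadamard

open Finset
open Literature.Combinatorics.Designs.DifferenceSets

/-! ### Arithmetic in `ZMod 667` and `ZMod 29` -/

/-- `667 = 23 · 29`; the reduction map `ZMod 667 → ZMod 29`. -/
theorem dvd_29_667 : (29 : ℕ) ∣ 667 := by norm_num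

/-- the projection `π : ℤ/667 → ℤ/29` (local notation, not a definition) -/
local notation "proj29" => (ZMod.castHom dvd_29_667 (ZMod 29) : ZMod 667 →+* ZMod 29)

/-- `167 · 4 = 668 ≡ 1 (mod 667)`: `4` is the inverse of the multiplier `167`. -/
theorem four_mul_167 : (4 : ZMod 667) * 167 = 1 := by decide

/-- the multiplier `167` reduces to `22` modulo `29`. -/
theorem proj29_167 : proj29 167 = 22 := by
  rw [map_ofNat]; decide

/-- and its inverse `4` reduces to `4`, the inverse of `22` modulo `29`. -/
theorem proj29_four : proj29 4 = 4 := by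
  rw [map_ofNat]

/-- the kernel of `π` (the subgroup of order `23`). -/
theorem card_ker_proj29 : (univ.filter fun h : ZMod 667 => proj29 h = 0).card = 23 := by
  have : (univ.filter fun h : ZMod 667 => proj29 h = 0) =
      (Finset.range 23).image fun i => ((29 * i : ℕ) : ZMod 667) := by
    ext h
    simp only [mem_filter, mem_univ, true_and, mem_image, mem_range, ZMod.castHom_apply]
    constructor
    · intro hh
      have hval : (h.val : ZMod 29) = 0 := by
        rw [ZMod.cast_eq_val] at hh; exact hh
      rw [ZMod.natCast_eq_zero_iff] at hval
      obtain ⟨i, hi⟩ := hval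
      refine ⟨i, ?_, ?_⟩
      · have := ZMod.val_lt h; omega
      · rw [← hi, ZMod.natCast_zmod_val]
    · rintro ⟨i, hi, rfl⟩
      rw [ZMod.cast_eq_val, ZMod.val_natCast, ZMod.natCast_eq_zero_iff]
      have : 29 * i < 667 := by omega
      rw [Nat.mod_eq_of_lt this]
      exact Dvd.intro i rfl
  rw [this, Finset.card_image_of_injOn, Finset.card_range]
  intro i hi j hj hij
  simp only [coe_range, Set.mem_Iio] at hi hj
  have h := (ZMod.natCast_eq_natCast_iff' _ _ 667).mp hij
  rw [Nat.mod_eq_of_lt (by omega), Nat.mod_eq_of_lt (by omega)] at h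
  omega

/-- the two orbits of `x ↦ 22x` on the non-zero residues modulo `29` (the squares and the non-squares),
as local notation -/
local notation "orbitQ" => (Finset.image (fun i : ℕ => (22 : ZMod 29) ^ i) (Finset.range 14))
/-- see `orbitQ` -/
local notation "orbitN" => (Finset.image (fun i : ℕ => 2 * (22 : ZMod 29) ^ i) (Finset.range 14))

/-- `|orbitQ| = 14` -/
theorem orbitQ_card : (orbitQ).card = 14 := by decide
/-- `|orbitN| = 14` -/
theorem orbitN_card : (orbitN).card = 14 := by decide
/-- `ℤ/29 = {0} ⊔ orbitQ ⊔ orbitN` -/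
theorem univ_eq_orbits : (univ : Finset (ZMod 29)) = insert 0 (orbitQ ∪ orbitN) := by decide
/-- the two orbits are disjoint -/
theorem disjoint_orbits : Disjoint orbitQ orbitN := by decide
/-- `0` is in neither orbit -/
theorem zero_notMem_orbits : (0 : ZMod 29) ∉ orbitQ ∪ orbitN := by decide

/-- a function on `ℤ/29` invariant under `j ↦ 22 j` is constant on the two orbits. -/
theorem sum_eq_of_invariant (c : ZMod 29 → ℕ) (hc : ∀ j, c (22 * j) = c j) (f : ℕ → ℕ) :
    ∑ j, f (c j) = f (c 0) + 14 * f (c 1) + 14 * f (c 2) := by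
  have hQ : ∀ i, c ((22 : ZMod 29) ^ i) = c 1 := by
    intro i
    induction i with
    | zero => simp
    | succ i ih => rw [pow_succ', hc, ih]
  have hN : ∀ i, c (2 * (22 : ZMod 29) ^ i) = c 2 := by
    intro i
    induction i with
    | zero => simp
    | succ i ih => rw [pow_succ', mul_left_comm, hc, ih]
  have hinjQ : Set.InjOn (fun i => (22 : ZMod 29) ^ i) ↑(Finset.range 14) :=
    Finset.card_image_iff.mp (by rw [Finset.card_range]; exact orbitQ_card)
  have hinjN : Set.InjOn (fun i => 2 * (22 : ZMod 29) ^ i) ↑(Finset.range 14) :=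
    Finset.card_image_iff.mp (by rw [Finset.card_range]; exact orbitN_card)
  rw [univ_eq_orbits, Finset.sum_insert zero_notMem_orbits, Finset.sum_union disjoint_orbits]
  rw [Finset.sum_image hinjQ, Finset.sum_image hinjN]
  simp_rw [hQ, hN]
  rw [Finset.sum_const, Finset.sum_const, Finset.card_range, smul_eq_mul]
  ring

/-- the final Diophantine impossibility: `a + 14 b + 14 b' = 333`, `a² + 14 b² + 14 b'² = 3985` has no solution
in natural numbers. -/
theorem no_nat_solution (a b b' : ℕ) (h1 : a + 14 * b + 14 * b' = 333)
    (h2 : a * a + 14 * (b * b) + 14 * (b' * b') = 3985) : False := by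
  have hb : b ≤ 23 := by omega
  have hb' : b' ≤ 23 := by omega
  have ha : a = 333 - 14 * b - 14 * b' := by omega
  subst ha
  have key : ∀ b ≤ 23, ∀ b' ≤ 23, 14 * b + 14 * b' ≤ 333 →
      (333 - 14 * b - 14 * b') * (333 - 14 * b - 14 * b') + 14 * (b * b) + 14 * (b' * b') ≠ 3985 := by
    decide
  exact key b hb b' hb' (by omega) h2

/-- **Fibre counts of a difference set under a homomorphism.** For a `(v,k,λ)` difference set `D ⊆ G` and an
additive homomorphism `π : G → Q`, the number of ordered pairs of elements of `D` with equal image is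
`k + (|ker π| - 1)·λ`; in terms of the fibre counts `c_j = #{x ∈ D | π x = j}`: `Σ_j c_j² = k + (|ker π| - 1) λ`
(the diagonal coefficient of the contracted equation `D̄ D̄⁻¹ = n + λ|H|·(G/H)`). -/
theorem sum_sq_fiberCard {G Q : Type*} [AddCommGroup G] [Fintype G] [DecidableEq G] [AddCommGroup Q]
    [Fintype Q] [DecidableEq Q] {D : Finset G} {lam : ℕ} (hD : IsDifferenceSet D lam) (π : G → Q)
    (hsub : ∀ a b, π (a - b) = π a - π b) (k K₀ : ℕ) (hk : D.card = k)
    (hK₀ : (univ.filter fun h : G => π h = 0).card = K₀) :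
    ∑ j, (D.filter fun x => π x = j).card * (D.filter fun x => π x = j).card = k + (K₀ - 1) * lam := by
  classical
  subst hk hK₀
  have hπ0 : π 0 = 0 := by have := hsub 0 0; rwa [sub_self, sub_self] at this
  set S := (D ×ˢ D).filter fun p : G × G => π p.1 = π p.2 with hSdef
  set K := (univ : Finset G).filter fun h => π h = 0 with hKdef
  -- fibre of S over j ∈ Q is (filter j) × (filter j)
  have hS1 : S.card = ∑ j, (D.filter fun x => π x = j).card * (D.filter fun x => π x = j).card := by
    rw [Finset.card_eq_sum_card_fiberwise (f := fun p : G × G => π p.1) (s := S) (t := univ)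
      (fun _ _ => mem_univ _)]
    refine Finset.sum_congr rfl fun j _ => ?_
    rw [← Finset.card_product]
    congr 1
    ext p
    simp only [hSdef, mem_filter, mem_product]
    constructor
    · rintro ⟨⟨⟨h1, h2⟩, h3⟩, h4⟩; exact ⟨⟨h1, h4⟩, ⟨h2, by rw [← h3, h4]⟩⟩
    · rintro ⟨⟨h1, h2⟩, ⟨h3, h4⟩⟩; exact ⟨⟨⟨h1, h3⟩, by rw [h2, h4]⟩, h2⟩
  -- fibre of S over h ∈ ker π under (x, y) ↦ x - y is the set of representations of h
  have hS2 : S.card = D.card + (K.card - 1) * lam := by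
    rw [Finset.card_eq_sum_card_fiberwise (f := fun p : G × G => p.1 - p.2) (s := S) (t := K) ?_]
    · have hfib : ∀ h ∈ K, (S.filter fun p : G × G => p.1 - p.2 = h).card = repCount D D h := by
        intro h hh
        rw [← card_pairs_eq]
        congr 1
        ext p
        simp only [hSdef, hKdef, mem_filter, mem_product, mem_univ, true_and] at hh ⊢
        constructor
        · rintro ⟨⟨hp, -⟩, hph⟩; exact ⟨hp, hph⟩
        · rintro ⟨hp, hph⟩
          refine ⟨⟨hp, ?_⟩, hph⟩
          have : π (p.1 - p.2) = 0 := by rw [hph]; exact hh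
          rwa [hsub, sub_eq_zero] at this
      have h0K : (0 : G) ∈ K := by simp [hKdef, hπ0]
      rw [Finset.sum_congr rfl hfib, ← Finset.add_sum_erase K _ h0K]
      have h0 : repCount D D 0 = D.card := by
        unfold repCount; congr 1; ext b; simp
      have hrest : ∀ h ∈ K.erase 0, repCount D D h = lam := by
        intro h hh; unfold repCount; exact hD h (Finset.ne_of_mem_erase hh)
      rw [h0, Finset.sum_congr rfl hrest, Finset.sum_const, Finset.card_erase_of_mem h0K, smul_eq_mul]
    · intro p hp
      simp only [Finset.mem_coe, hSdef, hKdef, mem_filter, mem_univ, true_and] at hp ⊢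
      rw [hsub, hp.2, sub_self]
  rw [← hS1, hS2]

/-! ### The theorem -/

/-- **No cyclic Paley–Hadamard difference set of order 167: there is no `(667, 333, 166)` difference set in
`ℤ/667`** (kernel). In print: Song–Golomb 1994 / Baumert–Gordon 2004 §4 (no cyclic Hadamard difference set with
`v < 10⁴` outside the three classical families, bar 17 listed cases; `667 = 23·29` is in none) — family F10 'one circulant
core' of the H(668) census of cell `pub-namedobj`, previously re-derived by computation (Mann test; 24 invariant
candidates), now a theorem: by Hall's multiplier theorem (Literature `DifferenceSetMultiplier`, Lander 1983
Thm 5.3) `167 ∣ n = 167`, `167 > λ = 166` is a multiplier; it fixes the translate with element-sum `0`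
(Lander Thm 5.10); reducing modulo `29` (where `167 ≡ 22` has the squares as its orbit) the fibre counts
`c₀, c_□ = b, c_⊠ = b'` satisfy `c₀ + 14b + 14b' = 333` and `c₀² + 14b² + 14b'² = k + 22λ = 3985`, which has no
solution in integers. -/
theorem no_cyclic_hadamard_differenceSet_667 (D : Finset (ZMod 667)) (hD : IsDifferenceSet D 166)
    (hcard : D.card = 333) : False := by
  classical
  have hcardG : Fintype.card (ZMod 667) = 667 := ZMod.card 667
  -- (1) sum-zero translate
  have hcop : (D.card).Coprime (Fintype.card (ZMod 667)) := by rw [hcard, hcardG]; norm_num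
  obtain ⟨g, hg⟩ := IsDifferenceSet.exists_translate_sum_eq_zero D hcop
  set D' := D.image fun x => x + g with hD'def
  have hD' : IsDifferenceSet D' 166 := hD.image_add_right g
  have hcard' : D'.card = 333 := by rw [hD'def, Finset.card_image_of_injective _ (add_left_injective g), hcard]
  have hcop' : (D'.card).Coprime (Fintype.card (ZMod 667)) := by rw [hcard', hcardG]; norm_num
  -- (2) 167 is a multiplier and fixes D'
  have hinj : Function.Injective fun x : ZMod 667 => (167 : ℕ) • x := by
    intro a b hab
    simp only [nsmul_eq_mul, Nat.cast_ofNat] at hab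
    calc a = (4 * 167) * a := by rw [four_mul_167, one_mul]
      _ = 4 * (167 * a) := by ring
      _ = 4 * (167 * b) := by rw [hab]
      _ = (4 * 167) * b := by ring
      _ = b := by rw [four_mul_167, one_mul]
  have h167 : D'.image (fun x => (167 : ℕ) • x) = D' := by
    have hp : Nat.Prime 167 := by norm_num
    obtain ⟨s, hs⟩ := hD'.multiplier hp (by norm_num) (by norm_num [hcard']) (by norm_num [hcard'])
      (by norm_num [hcardG])
    exact IsDifferenceSet.image_nsmul_eq_self_of_sum_eq_zero D' hcop' hg hinj hs
  have hmem167 : ∀ x ∈ D', (167 : ZMod 667) * x ∈ D' := by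
    intro x hx
    have : (167 : ℕ) • x ∈ D'.image (fun x => (167 : ℕ) • x) := mem_image_of_mem _ hx
    rw [h167] at this
    simpa [nsmul_eq_mul] using this
  have hmem4 : ∀ x ∈ D', (4 : ZMod 667) * x ∈ D' := by
    intro x hx
    rw [← h167, mem_image] at hx
    obtain ⟨y, hy, hyx⟩ := hx
    simp only [nsmul_eq_mul, Nat.cast_ofNat] at hyx
    have : (4 : ZMod 667) * x = y := by rw [← hyx, ← mul_assoc, four_mul_167, one_mul]
    rw [this]; exact hy
  -- (3) fibre counts modulo 29 and their invariance under 22 = π(167)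
  set c : ZMod 29 → ℕ := fun j => (D'.filter fun x => proj29 x = j).card with hcdef
  have hc : ∀ j, c (22 * j) = c j := by
    intro j
    simp only [hcdef]
    refine Finset.card_bij' (fun x _ => 4 * x) (fun y _ => 167 * y) ?_ ?_ ?_ ?_
    · intro x hx
      simp only [mem_filter] at hx ⊢
      refine ⟨hmem4 x hx.1, ?_⟩
      rw [map_mul, proj29_four, hx.2, ← mul_assoc]
      have : (4 : ZMod 29) * 22 = 1 := by decide
      rw [this, one_mul]
    · intro y hy
      simp only [mem_filter] at hy ⊢
      refine ⟨hmem167 y hy.1, ?_⟩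
      rw [map_mul, proj29_167, hy.2]
    · intro x _; rw [← mul_assoc, mul_comm (167 : ZMod 667) 4, four_mul_167, one_mul]
    · intro y _; rw [← mul_assoc, four_mul_167, one_mul]
  -- (4) Σ c = 333
  have hsum1 : ∑ j, c j = 333 := by
    rw [← hcard']
    exact (Finset.card_eq_sum_card_fiberwise (f := fun x => proj29 x) (s := D') (t := univ)
      (fun _ _ => mem_univ _)).symm
  -- (5) Σ c² = k + 22 λ = 3985, by counting pairs with equal residue
  have hsum2 : ∑ j, c j * c j = 3985 := by
    exact sum_sq_fiberCard hD' (fun x => proj29 x) (map_sub proj29) 333 23 hcard' card_ker_proj29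
  -- (6) constant on orbits, then arithmetic
  have e1 := sum_eq_of_invariant c hc id
  have e2 := sum_eq_of_invariant c hc fun t => t * t
  simp only [id] at e1 e2
  rw [hsum1] at e1
  rw [hsum2] at e2
  exact no_nat_solution (c 0) (c 1) (c 2) e1.symm e2.symm

/-! ### Corollary: no circulant core for a Hadamard matrix of order 668 -/

/-- **From a two-level autocorrelation sequence to a cyclic Hadamard difference set.** If `c : ℤ/v → {±1}` has
`PAF_c(s) = -1` for every `s ≠ 0` and `Σ c = -1`, then `D = {i | c i = 1}` satisfies
`#{b ∈ D | g + b ∈ D} = a` for `g ≠ 0` with `4a + v = 4|D| - 1`, and `2|D| + 1 = v`. -/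
theorem differenceSet_of_paf {v : ℕ} [NeZero v] (c : ZMod v → ℤ)
    (hc : Literature.Combinatorics.Designs.LegendrePairs.IsPM c)
    (hpaf : ∀ s : ZMod v, s ≠ 0 → Literature.Combinatorics.Designs.LegendrePairs.PAF c s = -1)
    (hsum : ∑ i, c i = -1) :
    (2 * ((univ.filter fun i => c i = 1).card : ℤ) + 1 = v) ∧
    ∀ g : ZMod v, g ≠ 0 →
      4 * (((univ.filter fun i => c i = 1).filter fun b => g + b ∈ univ.filter fun i => c i = 1).card : ℤ) + v =
        4 * ((univ.filter fun i => c i = 1).card : ℤ) - 1 := by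
  classical
  set D := (univ : Finset (ZMod v)).filter fun i => c i = 1 with hDdef
  -- the 0/1 indicator d with c = 2 d - 1
  set d : ZMod v → ℤ := fun i => if c i = 1 then 1 else 0 with hddef
  have hcd : ∀ i, c i = 2 * d i - 1 := by
    intro i
    rcases hc i with h | h
    · simp [hddef, h]
    · simp only [hddef, h]; norm_num
  have hdsum : ∑ i, d i = (D.card : ℤ) := by
    simp only [hddef, hDdef]
    rw [Finset.sum_boole]
  have hcard : 2 * (D.card : ℤ) + 1 = v := by
    have : ∑ i, c i = 2 * ∑ i, d i - (v : ℤ) := by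
      simp_rw [hcd]
      rw [Finset.sum_sub_distrib, ← Finset.mul_sum, Finset.sum_const, Finset.card_univ, ZMod.card]
      simp
    rw [hsum, hdsum] at this
    linarith
  refine ⟨hcard, fun g hg => ?_⟩
  have hpg := hpaf g hg
  unfold Literature.Combinatorics.Designs.LegendrePairs.PAF at hpg
  simp_rw [hcd] at hpg
  have hexp : ∀ i, (2 * d i - 1) * (2 * d (i + g) - 1) = 4 * (d i * d (i + g)) - 2 * d i - 2 * d (i + g) + 1 :=
    fun i => by ring
  simp_rw [hexp] at hpg
  rw [Finset.sum_add_distrib, Finset.sum_sub_distrib, Finset.sum_sub_distrib, ← Finset.mul_sum, ← Finset.mul_sum,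
    ← Finset.mul_sum, Finset.sum_const, Finset.card_univ, ZMod.card] at hpg
  have hshift : ∑ i, d (i + g) = ∑ i, d i := by
    have := Equiv.sum_comp (Equiv.addRight g) d
    simpa only [Equiv.coe_addRight] using this
  rw [hshift, hdsum] at hpg
  -- Σ d_i d_{i+g} is the representation count
  have hrep : ∑ i, d i * d (i + g) = ((D.filter fun b => g + b ∈ D).card : ℤ) := by
    have : ∀ i, d i * d (i + g) = if (c i = 1 ∧ c (g + i) = 1) then 1 else 0 := by
      intro i
      simp only [hddef, add_comm i g]
      by_cases h1 : c i = 1 <;> by_cases h2 : c (g + i) = 1 <;> simp [h1, h2]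
    simp_rw [this]
    rw [Finset.sum_boole]
    congr 1
    congr 1
    ext b
    simp [hDdef]
  rw [hrep, nsmul_eq_mul, mul_one] at hpg
  linarith

/-- **No Hadamard matrix of order 668 with a circulant core** (family F10 of the H(668) census, in the kernel):
there is no `±1` sequence of length `667` whose periodic autocorrelation is `-1` at every non-zero shift
(equivalently, no cyclic `(667,333,166)` Paley–Hadamard difference set; the first row of a circulant core
`C`, `C Cᵀ = 668·I - J`, of a normalised `H(668)` would be such a sequence). -/
theorem no_twoLevel_autocorrelation_667 (c : ZMod 667 → ℤ)
    (hc : Literature.Combinatorics.Designs.LegendrePairs.IsPM c)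
    (hpaf : ∀ s : ZMod 667, s ≠ 0 → Literature.Combinatorics.Designs.LegendrePairs.PAF c s = -1) : False := by
  classical
  -- the row sum is ±1: (Σ c)² = Σ_s PAF = 667 - 666
  have hsq : (∑ i, c i) ^ 2 = 1 := by
    rw [Literature.Combinatorics.Designs.LegendrePairs.sq_rowsum,
      ← Finset.add_sum_erase _ _ (mem_univ (0 : ZMod 667)),
      Literature.Combinatorics.Designs.LegendrePairs.paf_zero c hc,
      Finset.sum_congr rfl fun s hs => hpaf s (Finset.ne_of_mem_erase hs), Finset.sum_const,
      Finset.card_erase_of_mem (mem_univ _), Finset.card_univ, ZMod.card]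
    norm_num
  -- normalise the sign so that Σ c' = -1
  obtain ⟨c', hc', hpaf', hsum'⟩ : ∃ c' : ZMod 667 → ℤ, Literature.Combinatorics.Designs.LegendrePairs.IsPM c' ∧
      (∀ s : ZMod 667, s ≠ 0 → Literature.Combinatorics.Designs.LegendrePairs.PAF c' s = -1) ∧ ∑ i, c' i = -1 := by
    have h1 : (∑ i, c i - 1) * (∑ i, c i + 1) = 0 := by nlinarith [hsq]
    rcases mul_eq_zero.mp h1 with h | h
    · -- Σ c = 1: negate
      refine ⟨fun i => -c i, fun i => ?_, fun s hs => ?_, ?_⟩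
      · rcases hc i with h' | h' <;> simp [h']
      · unfold Literature.Combinatorics.Designs.LegendrePairs.PAF at hpaf ⊢
        simp only [neg_mul_neg]; exact hpaf s hs
      · rw [Finset.sum_neg_distrib]; linarith
    · exact ⟨c, hc, hpaf, by linarith⟩
  obtain ⟨hcard, hrep⟩ := differenceSet_of_paf c' hc' hpaf' hsum'
  set D := (univ : Finset (ZMod 667)).filter fun i => c' i = 1 with hDdef
  have hk : D.card = 333 := by
    have : (2 * (D.card : ℤ) + 1 = 667) := by exact_mod_cast hcard
    omega
  have hD : IsDifferenceSet D 166 := by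
    intro g hg
    have h := hrep g hg
    rw [hk] at h
    push_cast at h
    omega
  exact no_cyclic_hadamard_differenceSet_667 D hD hk

/-- **No Hadamard matrix of order 668 in bordered-circulant form** (`IsHadamardMatrix` of Literature
`GoethalsSeidelArray`): if `H` is indexed by `Option (ℤ/667)` (`none` = the border), has border column `+1`
and a circulant core `H (some i) (some j) = c (j - i)`, then `H Hᵀ ≠ 668·I`. (Any `H(668)` with a circulant core is
brought to this form by negating rows.) -/
theorem no_hadamard668_circulant_core (c : ZMod 667 → ℤ) (H : Matrix (Option (ZMod 667)) (Option (ZMod 667)) ℤ)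
    (hH : Literature.Combinatorics.Designs.GoethalsSeidel.IsHadamardMatrix H)
    (hcol : ∀ i, H i none = 1) (hcore : ∀ i j, H (some i) (some j) = c (j - i)) :
    False := by
  classical
  obtain ⟨hpm, hgram⟩ := hH
  have hc : Literature.Combinatorics.Designs.LegendrePairs.IsPM c := by
    intro t
    have := hpm (some 0) (some t)
    rwa [hcore, sub_zero] at this
  refine no_twoLevel_autocorrelation_667 c hc fun s hs => ?_
  -- entry (some 0, some s) of H Hᵀ = 668 • 1 is 0
  have h := congrArg (fun M => M (some 0) (some s)) hgram
  simp only [Matrix.mul_apply, Matrix.transpose_apply, Matrix.smul_apply, Fintype.sum_option, hcol, hcore,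
    mul_one, sub_zero] at h
  have hne : (some 0 : Option (ZMod 667)) ≠ some s := fun h' => hs (Option.some_injective _ h').symm
  rw [Matrix.one_apply_ne hne, smul_zero] at h
  -- the remaining sum is PAF_c(s) after the substitution k ↦ k + s
  unfold Literature.Combinatorics.Designs.LegendrePairs.PAF
  have hre : ∑ k : ZMod 667, c k * c (k - s) = ∑ i : ZMod 667, c i * c (i + s) := by
    have := Equiv.sum_comp (Equiv.addRight s) (fun k => c k * c (k - s))
    simp only [Equiv.coe_addRight, add_sub_cancel_right] at this
    rw [← this]
    exact Finset.sum_congr rfl fun i _ => by ring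
  linarith [hre]

end Summit.Ventures.DiscreteObjects.Hadamard
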